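import Literature.AlgebraicGeometry.Frobenioids.PerfectionBiratCommuteEquiv
import Literature.AlgebraicGeometry.Frobenioids.PerfectionStandardTypes
import Literature.AlgebraicGeometry.Frobenioids.PerfectionLifting
import Mathlib.CategoryTheory.Endomorphism
import HarnessLib

/-!
# Frobenioids I, Proposition 5.5 (iii), "model": `C^pf` is of birationally Frobenius-normalized type —
# transport along the comparison `(C^pf)^birat → (C^birat)^pf` of Prop. 5.5 (ii)

Mochizuki, *The geometry of Frobenioids I: the general theory*, Kyushu J. Math. **62** (2008)
293–400, Prop. 5.5 (iii), first sentence ("if `C` is of … model type, then so is `C^pf`"), proof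
p. 105 ll. 11–20: "by assertion (ii), we have natural equivalences … `(C^birat)^pf ⥲ (C^pf)^birat` …
assertion (iii) for `C^pf` follows immediately from the definitions [cf. also Proposition 3.2, (ii),
(iii)]" [cite: MochizukiFrdI2008, Prop. 5.5 (iii) p.104].

PROOF-ONLY file (cell abc-iut, row `FrdI:Prop5.5(iii)/P55-L06 PfPreservesStandardTypes`, MODEL slot
`FrdI.Prop55Sub.Prop55iii_pf_model`, its SECOND conjunct; seat abc-iut-w5-d042; no new notions).
"Model type" = pre-model (Def. 2.7 (iii)) AND birationally Frobenius-normalized (Def. 4.5 (i): every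
`A^birat` is Frobenius-normalized in `C^birat`).  The birational half transfers to `C^pf` along THE
comparison functor `K : (C^pf)^birat → (C^birat)^pf` of Prop. 5.5 (ii) (seat abc-iut-w4-d044,
`PerfectionBirat.comparison`; an equivalence, in particular FAITHFUL, `comparison_faithful`, lying over `D`
ON THE NOSE, `comparison_comp_base`):
* `K` preserves Frobenius degrees (`degFr_comparison_map`: `K[(α, φ′)] = P(α)⁻¹ ≫ P(φ′)` with
  `P = (C → C^birat)^pf` degree-preserving, `degFr_perfMap_map`, and isomorphisms of degree `1`), hence
  base-identity endomorphisms and `O^▷` (`isBaseIdentity_comparison_map`, `mem_endSubmonoid_comparison_map`);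
* `(C^birat)^pf` is of Frobenius-normalized type when `C^birat` is (the perfection clause (c) of
  Def. 3.1 (i), `Perfection.isOfFrobeniusNormalizedType_ops` of `PerfectionStandardTypes.lean`, applied to
  the Frobenioid `C^birat → F_{0_D}` — GIVEN that it is one, Prop. 4.4 (ii), hypothesis `hBi`), and every
  object of `C^birat` is an `A^birat` (`isOfFrobeniusNormalizedType_ops_birat`);
* so an identity `γ^d ∘ g = g ∘ γ` required in `(C^pf)^birat` holds after `K` and is reflected by
  faithfulness (`isFrobeniusNormalized_of_comparison`, `isOfBiratFrobeniusNormalizedType_biratData_perfection`).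
Closer: `FrdI.Prop55Sub.prop55iii_pf_model_of` — the model slot GIVEN `hBi` (Prop. 4.4 (ii) by name) and
GIVEN its pre-model conjunct as the hypothesis `hpre` (sub-row P55-L06c `PerfectionBaseFrobeniusPair`, seat
abc-iut-w5-d048: THE base-Frobenius pair of `C^pf`); CONDITIONAL on both, said so.  No statement of the
paper is restated or strengthened; HONEST FRAMING: nothing here bears on [IUTchIII] Cor. 3.12.
-/

namespace Literature.AlgebraicGeometry.Frobenioids

open CategoryTheory Opposite

universe w v v' u u'

namespace PreFrobenioid

variable {D : Type u} [Category.{v} D] {Φ : Dᵒᵖ ⥤ CommMonCat.{w}}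
  {C : Type u'} [Category.{v'} C] {F : C ⥤ ElemFrobenioid Φ}
  {hF : IsFrobenioid F} {hsq : HasBiratSquares F}
  {hBi : IsFrobenioid (biratOps hF hsq).toFunctor}
  {hPf : IsFrobenioid (Perfection.ops hF).toFunctor}
  {hsq' : HasBiratSquares (Perfection.ops hF).toFunctor}

namespace PerfectionBirat

/-! ### The comparison functor preserves Frobenius degrees, base-identity endomorphisms and `O^▷` -/

/-- `P = (C → C^birat)^pf : C^pf → (C^birat)^pf` preserves Frobenius degrees: the image of a class
`[θ : A^{(a)} → B^{(b)}]` is the class of `j_A⁻¹ ≫ θ^birat ≫ j_B`, and `C → C^birat` preserves degrees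
(Prop. 4.4 (i)). [cite: MochizukiFrdI2008, Prop. 4.4 (i) p.83] -/
theorem degFr_perfMap_map {X Y : Perfection hF} (f : X ⟶ Y) :
    (Perfection.ops hBi).degFr ((perfMap hF hsq hBi).map f) = (Perfection.ops hF).degFr f := by
  obtain ⟨r, rfl⟩ := Perfection.Hom.mk_surjective f
  rw [perfMap_map_mk]
  change PreFrobenioid.degFr (biratOps hF hsq).toFunctor
      (Perfection.repMap (hF₁ := hF) (hF₂ := hBi) (isFrobeniusCompatible_toBirat hF hsq) r).hom =
    PreFrobenioid.degFr F r.hom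
  rw [Perfection.repMap_hom]
  exact (degFr_iso_comp _ _).trans ((degFr_comp_iso _ _).trans (biratOps_degFr_toBirat r.hom))

/-- **The comparison functor `(C^pf)^birat → (C^birat)^pf` preserves Frobenius degrees**:
`deg_Fr(P(α)⁻¹ ≫ P(φ′)) = deg_Fr(φ′) = deg_Fr([(α, φ′)])`. [cite: MochizukiFrdI2008, Prop. 5.5 (ii) p.104] -/
theorem degFr_comparison_map {X Y : Birat (Perfection.ops hF).toFunctor hPf hsq'} (g : X ⟶ Y) :
    (Perfection.ops hBi).degFr ((comparison hF hsq hPf hsq' hBi).map g) = (biratOps hPf hsq').degFr g := by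
  obtain ⟨f, rfl⟩ := Birat.homMk_surjective g
  rw [comparison_map_homMk, biratOps_degFr_homMk]
  haveI : IsIso ((perfMap hF hsq hBi).map f.den) := perfMap_inverts hBi f.den f.den_mem
  calc (Perfection.ops hBi).degFr (inv ((perfMap hF hsq hBi).map f.den) ≫ (perfMap hF hsq hBi).map f.num)
      = (Perfection.ops hBi).degFr (inv ((perfMap hF hsq hBi).map f.den)) *
          (Perfection.ops hBi).degFr ((perfMap hF hsq hBi).map f.num) :=
        (Perfection.ops hBi).degFr_comp _ _
    _ = (Perfection.ops hBi).degFr ((perfMap hF hsq hBi).map f.num) := by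
        rw [Perfection.degFr_eq_one_of_isIso, one_mul]
    _ = (Perfection.ops hF).degFr f.num := degFr_perfMap_map f.num
    _ = f.deg := rfl

/-- The comparison functor preserves base-identity endomorphisms (it lies over `D` on the nose).
[cite: MochizukiFrdI2008, Prop. 5.5 (ii) p.104] -/
theorem isBaseIdentity_comparison_map {X : Birat (Perfection.ops hF).toFunctor hPf hsq'} {g : X ⟶ X}
    (hg : (biratOps hPf hsq').IsBaseIdentity g) :
    (Perfection.ops hBi).IsBaseIdentity ((comparison hF hsq hPf hsq' hBi).map g) := by
  have h := Functor.congr_hom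
    (comparison_comp_base (hF := hF) (hsq := hsq) (hPf := hPf) (hsq' := hsq') (hBi := hBi)) g
  change (comparison hF hsq hPf hsq' hBi ⋙ (Perfection.ops hBi).base).map g = 𝟙 _
  rw [h, show (biratOps hPf hsq').base.map g = 𝟙 _ from hg, Category.id_comp, eqToHom_trans, eqToHom_refl]

/-- The comparison functor carries `O^▷(X)` into `O^▷(K X)`. [cite: MochizukiFrdI2008, Prop. 5.5 (ii) p.104] -/
theorem mem_endSubmonoid_comparison_map {X : Birat (Perfection.ops hF).toFunctor hPf hsq'} {g : End X}
    (hg : g ∈ (biratOps hPf hsq').endSubmonoid X) :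
    (show End ((comparison hF hsq hPf hsq' hBi).obj X) from (comparison hF hsq hPf hsq' hBi).map g) ∈
      (Perfection.ops hBi).endSubmonoid ((comparison hF hsq hPf hsq' hBi).obj X) :=
  ⟨isBaseIdentity_comparison_map hg.1, by
    change (Perfection.ops hBi).degFr _ = 1
    rw [degFr_comparison_map]
    exact hg.2⟩

/-! ### Frobenius normalization: reflected by the comparison, supplied by the perfection of `C^birat` -/

/-- **An object of `(C^pf)^birat` is Frobenius-normalized as soon as `(C^birat)^pf` is of Frobenius-normalized
type**: the required identity `γ^d ∘ g = g ∘ γ` holds after the comparison functor (same degree, base-identity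
and `O^▷` data) and the comparison functor is faithful. [cite: MochizukiFrdI2008, Prop. 5.5 (iii) p.105] -/
theorem isFrobeniusNormalized_of_comparison (hn : (Perfection.ops hBi).IsOfFrobeniusNormalizedType)
    (X : Birat (Perfection.ops hF).toFunctor hPf hsq') : (biratOps hPf hsq').IsFrobeniusNormalized X := by
  intro φ hφ α hα
  haveI := comparison_faithful (hF := hF) (hsq := hsq) (hPf := hPf) (hsq' := hsq') (hBi := hBi)
  have key := hn.obj ((comparison hF hsq hPf hsq' hBi).obj X) ((comparison hF hsq hPf hsq' hBi).map φ)
    (isBaseIdentity_comparison_map hφ) ((comparison hF hsq hPf hsq' hBi).map α)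
    (mem_endSubmonoid_comparison_map hα)
  rw [degFr_comparison_map] at key
  change ((comparison hF hsq hPf hsq' hBi).mapEnd X α) ^ _ * (comparison hF hsq hPf hsq' hBi).mapEnd X φ =
    (comparison hF hsq hPf hsq' hBi).mapEnd X φ * (comparison hF hsq hPf hsq' hBi).mapEnd X α at key
  rw [← map_pow, ← map_mul, ← map_mul] at key
  exact (comparison hF hsq hPf hsq' hBi).map_injective key

/-- `(C^birat)^pf` is of Frobenius-normalized type if `C` is of birationally Frobenius-normalized type
(every object of `C^birat` is an `A^birat`, Frobenius-normalized by Def. 4.5 (i); then the perfection clause,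
`Perfection.isOfFrobeniusNormalizedType_ops`, for the Frobenioid `C^birat → F_{0_D}`, Prop. 4.4 (ii) `hBi`).
[cite: MochizukiFrdI2008, Prop. 5.5 (iii) p.105] -/
theorem isOfFrobeniusNormalizedType_ops_birat
    (hnb : PreFrobenioidData.IsOfBiratFrobeniusNormalizedType (biratData hF hsq)) :
    (Perfection.ops hBi).IsOfFrobeniusNormalizedType :=
  Perfection.isOfFrobeniusNormalizedType_ops hBi ⟨fun X => hnb.obj X.out⟩

/-- **Prop. 5.5 (iii), model type, the birational conjunct for `C^pf`**: THE birationalization of `C^pf` is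
of birationally Frobenius-normalized type if `C` is — GIVEN that `C^pf` and `C^birat` are Frobenioids
(Prop. 3.2 (iii) `hPf`, Prop. 4.4 (ii) `hBi`, by name). [cite: MochizukiFrdI2008, Prop. 5.5 (iii) p.104] -/
theorem isOfBiratFrobeniusNormalizedType_biratData_perfection
    (hPf₁ : IsFrobenioid (Perfection.ops hF).toFunctor) (hsq₁ : HasBiratSquares (Perfection.ops hF).toFunctor)
    (hBi₁ : IsFrobenioid (biratOps hF hsq).toFunctor)
    (hnb : PreFrobenioidData.IsOfBiratFrobeniusNormalizedType (biratData hF hsq)) :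
    PreFrobenioidData.IsOfBiratFrobeniusNormalizedType (biratData hPf₁ hsq₁) :=
  ⟨fun X => isFrobeniusNormalized_of_comparison (hsq := hsq) (hBi := hBi₁) (hPf := hPf₁) (hsq' := hsq₁)
    (isOfFrobeniusNormalizedType_ops_birat hnb) ((toBirat _ hPf₁ hsq₁).obj X)⟩

end PerfectionBirat

end PreFrobenioid

/-! ### The model slot of `Prop55Sub.lean`, under Prop. 4.4 (ii) and the pre-model conjunct -/

namespace FrdI.Prop55Sub

open PreFrobenioid

variable {D : Type u} [Category.{v} D] {Φ : Dᵒᵖ ⥤ CommMonCat.{w}}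
  {C : Type u'} [Category.{v'} C] {F : C ⥤ ElemFrobenioid Φ}

/-- **Proposition 5.5 (iii), "if `C` is of model type, then so is `C^pf`"** — the slot
`Prop55iii_pf_model F hF`, GIVEN (1) that `C^birat → F_{0_D}` is a Frobenioid (Prop. 4.4 (ii), hypothesis
`hBi`, by name) and (2) the PRE-MODEL conjunct as the hypothesis `hpre` (a base-Frobenius pair of `C^pf` from
one of `C`: sub-row P55-L06c, seat abc-iut-w5-d048, consumed by name when it lands).  The birational
conjunct is proved: `PerfectionBirat.isOfBiratFrobeniusNormalizedType_biratData_perfection`.  CONDITIONAL on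
(1)(2).  [cite: MochizukiFrdI2008, Prop. 5.5 (iii) p.104] -/
theorem prop55iii_pf_model_of (hF : IsFrobenioid F)
    (hBi : IsFrobenioid (biratOps hF (hasBiratSquares_of_isFrobenioid hF)).toFunctor)
    (hpre : IsOfPreModelType F → IsOfPreModelType (Perfection.ops hF).toFunctor) :
    Prop55iii_pf_model F hF := fun _ _ hPf h =>
  ⟨hpre h.1, PerfectionBirat.isOfBiratFrobeniusNormalizedType_biratData_perfection hPf
    (hasBiratSquares_of_isFrobenioid hPf) hBi h.2⟩

end FrdI.Prop55Sub

end Literature.AlgebraicGeometry.Frobenioids
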